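import Summits.ResolutionOfSingularities.ResolutionOfSingularities.Theorems.FRationalModification.Negative.RungTwoNotRungThreeRing

/-!
# `FRationalModification` — negative lemmas II(b): a rung-2 local ring that is not rung-3

Support (negative) lemma for crux `stmt-ResolutionOfSingularities-15316`
(`Summit.ResolutionOfSingularities.ResolutionOfSingularities.Theses.FrobeniusLadder.FRationalModification`,
route FrobeniusLadder, rank 3), filed by the standing disprover (cdisprove gen 1, cycle 1; work file
`Cruxes/FRationalModification/Disproof.lean`, §3). The crux asks for a NEW proper birational model
`X₂ → X` with F-rational stalks, given one (`X₁`) with locally integral Cohen–Macaulay F-injective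
stalks. The cheapest conceivable proof shape, `X₂ := X₁` — "every rung-2 Noetherian local ring of prime
characteristic is rung-3" (`LocalRungClimb`, written inline; rung-2 / rung-3 are the route's stalk
predicates verbatim) — is FALSE at every prime `p` (`localRungClimb_false_at`, `localRungClimb_false`,
`exists_rungTwo_not_rungThree`). No definition is declared.

WITNESS (general form, `Negative/RungTwoNotRungThreeRing.lean`): `R = K + X·L⟦X⟧` for a field `L` of
characteristic `p` and a subfield `K` (hypothesis `hR : f ∈ R ↔ f(0) ∈ K`):
* RUNG 2 HOLDS when `K` is Frobenius-saturated in `L` (`x^p ∈ K ⇒ x ∈ K`) and `[L : K] < ∞`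
  (`rungTwo_of_mem_iff`): `R` is a domain of dimension one, a system of parameters is one nonzero
  non-unit `a`, `[a]` is a regular sequence, and `(a)` is Frobenius closed (`mem_span_of_pow_mem`:
  `y^q = r a^q` forces `a ∣ y` in the DVR `L⟦X⟧`, say `y = a b`, and `b^q = r ∈ R` gives `b(0)^q ∈ K`,
  hence `b(0) ∈ K`, i.e. `b ∈ R`);
* RUNG 3 FAILS when `K ≠ L` (`not_rungThree_of_mem_iff`): `(X)` is a parameter ideal, `ωX ∉ (X)` for
  `ω ∈ L ∖ K`, yet `X·(ωX)^q = (ω^q X)·X^q ∈ (X)^[q]` for every `q = p^e`, with `c = X ≠ 0` (`R` is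
  not normal: `ωX/X = ω` is integral over `R`).
Instance at every prime: `L = 𝔽_{p²}`, `K = 𝔽_p` (Frobenius-saturated by `mem_fieldRange_of_pow_mem`,
proper by `exists_not_mem_fieldRange`); for `p = 3` this is the completed local ring of the integral
plane curve `x² + y² = 0` over `𝔽₃` at the origin (F-pure, non-normal, a node over `𝔽₉`).
READING FOR THE PROVER: rung 2 (CM + F-injective, locally integral) does not even imply normality; the
F-rational modification of the crux must move — at least normalise — already in dimension one, at every
prime; in dimension one normalisation is exactly the required modification.

## Sources
* R. Fedder, K.-i. Watanabe, MSRI Publ. 15 (1989), Def. 1.5 / 1.10, Remark 1.9 (Frobenius closure,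
  F-rational; tree vocabulary `Literature/RingTheory/TightClosure`).
* M. Hochster, C. Huneke, Trans. Amer. Math. Soc. 346 (1994), Thm. 4.2 (F-rational ⇒ normal — the
  printed reason the witness cannot be rung-3). The witness is folklore (a seminormal non-normal curve
  germ with a residue field extension in its normalisation).
-/

noncomputable section

open IsLocalRing Literature.RingTheory.TightClosure

-- single-problem summit: the doubled namespace component `ResolutionOfSingularities` is forced
set_option linter.dupNamespace false

namespace Summit.ResolutionOfSingularities.ResolutionOfSingularities.Theorems.FRationalModification.Negative

section Witness

variable {p : ℕ} [Fact p.Prime] {L : Type} [Field L] [CharP L p] (K : Subfield L)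
  (R : Subring (PowerSeries L)) (hR : ∀ f : PowerSeries L, f ∈ R ↔ PowerSeries.constantCoeff f ∈ K)
include hR

/-- **Principal ideals of `R = K + X·L⟦X⟧` are Frobenius closed** when `K` is Frobenius-saturated in
`L`: if `y^q ∈ (a^q)` (`q = p^e`, `a ≠ 0`) then `a ∣ y` in `L⟦X⟧`, say `y = a b`, and `b^q ∈ R`
forces `b(0)^q ∈ K`, hence `b(0) ∈ K`, i.e. `b ∈ R`. [folklore] -/
theorem mem_span_of_pow_mem (hK : ∀ x : L, x ^ p ∈ K → x ∈ K) {a y : R} (ha : a ≠ 0) (e : ℕ)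
    (h : y ^ p ^ e ∈ Ideal.span ((fun z : R => z ^ p ^ e) '' (Ideal.span {a} : Set R))) :
    y ∈ Ideal.span {a} := by
  haveI := charP_of_mem_iff R p
  have hq : 0 < p ^ e := pow_pos (Fact.out : p.Prime).pos e
  change y ^ p ^ e ∈ frobeniusPower (p ^ e) (Ideal.span {a}) at h
  rw [frobeniusPower_span, Set.image_singleton, Ideal.mem_span_singleton'] at h
  obtain ⟨r, hr⟩ := h
  have ha' : (a : PowerSeries L) ≠ 0 := fun h => ha (Subtype.ext h)
  have hr' : (y : PowerSeries L) ^ p ^ e = (r : PowerSeries L) * (a : PowerSeries L) ^ p ^ e := by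
    have := congrArg Subtype.val hr
    simpa using this.symm
  obtain ⟨b, hb⟩ := dvd_of_pow_eq_mul_pow ha' hq hr'
  have hbq : b ^ p ^ e = r := by
    apply mul_left_cancel₀ (pow_ne_zero (p ^ e) ha')
    rw [← mul_pow, ← hb, hr', mul_comm]
  -- `K` is saturated under all iterates of Frobenius
  have hKe : ∀ (n : ℕ) (x : L), x ^ p ^ n ∈ K → x ∈ K := by
    intro n
    induction n with
    | zero => intro x hx; simpa using hx
    | succ n ih => intro x hx; rw [pow_succ', pow_mul] at hx; exact hK x (ih _ hx)
  have hbR : b ∈ R := by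
    rw [hR]
    apply hKe e
    rw [← map_pow, hbq]
    exact (hR _).mp r.2
  exact Ideal.mem_span_singleton'.mpr ⟨⟨b, hbR⟩, Subtype.ext (by simp [hb, mul_comm])⟩

/-- **RUNG 2 HOLDS in `R = K + X·L⟦X⟧`** (`K` Frobenius-saturated in `L`, `[L : K] < ∞`): `R` is a
domain with `dim R = 1`, a system of parameters is one nonzero non-unit `a`, `[a]` is a (weakly) regular
sequence and `(a)` is Frobenius closed. [folklore] -/
theorem rungTwo_of_mem_iff [Module.Finite K L] (hK : ∀ x : L, x ^ p ∈ K → x ∈ K) :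
    (IsDomain R ∧ ∀ d : ℕ, ringKrullDim R = d → ∀ s : Fin d → R,
        (Ideal.span (Set.range s)).radical.IsMaximal →
          RingTheory.Sequence.IsWeaklyRegular R (List.ofFn s) ∧
            ∀ y : R, (∃ e : ℕ, y ^ p ^ e ∈ Ideal.span ((fun z : R => z ^ p ^ e) ''
              (Ideal.span (Set.range s) : Set R))) → y ∈ Ideal.span (Set.range s)) := by
  haveI := isLocalRing_of_mem_iff K R hR
  refine ⟨inferInstance, fun d hd s hs => ?_⟩
  have hd1 : d = 1 := by
    have h := (ringKrullDim_of_mem_iff K R hR).symm.trans hd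
    exact_mod_cast h.symm
  subst hd1
  have hrange : Set.range s = {s 0} := by rw [Set.range_unique]; rfl
  rw [hrange] at hs ⊢
  have ha : s 0 ≠ 0 := by
    intro h0
    rw [h0, Ideal.span_singleton_zero, Ideal.radical_bot_of_noZeroDivisors] at hs
    have hX : (⟨PowerSeries.X, X_mem K R hR⟩ : R) ∈ maximalIdeal R :=
      (IsLocalRing.mem_maximalIdeal _).mpr (mem_nonunits_iff.mpr (not_isUnit_X K R hR))
    rw [← IsLocalRing.eq_maximalIdeal hs, Ideal.mem_bot] at hX
    exact PowerSeries.X_ne_zero (congrArg Subtype.val hX)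
  refine ⟨?_, fun y ⟨e, hy⟩ => mem_span_of_pow_mem K R hR hK ha e hy⟩
  have hofn : List.ofFn s = [s 0] := by simp [List.ofFn_succ]
  rw [hofn, RingTheory.Sequence.isWeaklyRegular_cons_iff]
  exact ⟨fun x y h => mul_left_cancel₀ ha h, RingTheory.Sequence.IsWeaklyRegular.nil _ _⟩

omit [Fact p.Prime] [CharP L p] in
/-- **RUNG 3 FAILS in `R = K + X·L⟦X⟧`** when `K ≠ L`: `(X)` is a parameter ideal and `X ≠ 0`, yet
for `ω ∈ L ∖ K` one has `X · (ωX)^q = (ω^q X) · X^q ∈ (X)^[q]` for all `q = p^e` while `ωX ∉ (X)`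
(`(X)` is not tightly closed; `R` is not F-rational — indeed not normal). [folklore] -/
theorem not_rungThree_of_mem_iff (hω : ∃ ω : L, ω ∉ K) :
    ¬ (IsDomain R ∧ ∀ d : ℕ, ringKrullDim R = d → ∀ s : Fin d → R,
        (Ideal.span (Set.range s)).radical.IsMaximal → ∀ y c : R, c ≠ 0 →
          (∀ e : ℕ, c * y ^ p ^ e ∈ Ideal.span ((fun z : R => z ^ p ^ e) ''
            (Ideal.span (Set.range s) : Set R))) → y ∈ Ideal.span (Set.range s)) := by
  haveI := isLocalRing_of_mem_iff K R hR
  rintro ⟨-, h⟩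
  obtain ⟨ω, hω⟩ := hω
  let y : R := ⟨PowerSeries.C ω * PowerSeries.X, by rw [hR]; simp⟩
  set xR : R := ⟨PowerSeries.X, X_mem K R hR⟩ with hxR
  have hx0 : xR ≠ 0 := fun h0 => PowerSeries.X_ne_zero (congrArg Subtype.val h0)
  have hrange : Set.range (fun _ : Fin 1 => xR) = {xR} := Set.range_const
  have hs : (Ideal.span (Set.range fun _ : Fin 1 => xR)).radical.IsMaximal := by
    rw [hrange]; exact isMaximal_radical_span_X K R hR
  have key := h 1 (ringKrullDim_of_mem_iff K R hR) (fun _ => xR) hs y xR hx0 ?_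
  · rw [hrange, Ideal.mem_span_singleton'] at key
    obtain ⟨r, hr⟩ := key
    have hr' : (r : PowerSeries L) * PowerSeries.X = PowerSeries.C ω * PowerSeries.X :=
      congrArg Subtype.val hr
    have hrC : (r : PowerSeries L) = PowerSeries.C ω := mul_right_cancel₀ PowerSeries.X_ne_zero hr'
    apply hω
    have := (hR _).mp r.2
    rwa [hrC, PowerSeries.constantCoeff_C] at this
  · intro e
    rw [hrange]
    have hmem : xR ^ p ^ e ∈ (fun z : R => z ^ p ^ e) '' (Ideal.span {xR} : Set R) :=
      ⟨xR, Ideal.subset_span rfl, rfl⟩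
    let w : R := ⟨PowerSeries.C (ω ^ p ^ e) * PowerSeries.X, by rw [hR]; simp⟩
    have heq : xR * y ^ p ^ e = w * xR ^ p ^ e := by
      apply Subtype.ext
      show PowerSeries.X * (PowerSeries.C ω * PowerSeries.X) ^ p ^ e =
        PowerSeries.C (ω ^ p ^ e) * PowerSeries.X * PowerSeries.X ^ p ^ e
      rw [map_pow]; ring
    rw [heq]
    exact Ideal.mul_mem_left _ _ (Ideal.subset_span hmem)

end Witness

/-! ## The instance `L = 𝔽_{p²}`, `K = 𝔽_p` at every prime -/

/-- **At EVERY prime `p` there is a rung-2 Noetherian local ring of characteristic `p` (of dimension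
one) that is not rung-3**: `𝔽_p + X·𝔽_{p²}⟦X⟧`. [folklore] -/
theorem exists_rungTwo_not_rungThree (p : ℕ) (hp : p.Prime) :
    ∃ (R : Type) (_ : CommRing R) (_ : IsNoetherianRing R) (_ : IsLocalRing R) (_ : CharP R p),
      (IsDomain R ∧ ∀ d : ℕ, ringKrullDim R = d → ∀ s : Fin d → R,
        (Ideal.span (Set.range s)).radical.IsMaximal →
          RingTheory.Sequence.IsWeaklyRegular R (List.ofFn s) ∧
            ∀ y : R, (∃ e : ℕ, y ^ p ^ e ∈ Ideal.span ((fun z : R => z ^ p ^ e) ''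
              (Ideal.span (Set.range s) : Set R))) → y ∈ Ideal.span (Set.range s)) ∧
      ¬ (IsDomain R ∧ ∀ d : ℕ, ringKrullDim R = d → ∀ s : Fin d → R,
        (Ideal.span (Set.range s)).radical.IsMaximal → ∀ y c : R, c ≠ 0 →
          (∀ e : ℕ, c * y ^ p ^ e ∈ Ideal.span ((fun z : R => z ^ p ^ e) ''
            (Ideal.span (Set.range s) : Set R))) → y ∈ Ideal.span (Set.range s)) := by
  haveI : Fact p.Prime := ⟨hp⟩
  set K : Subfield (GaloisField p 2) := (ZMod.castHom (dvd_refl p) (GaloisField p 2)).fieldRange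
  set R : Subring (PowerSeries (GaloisField p 2)) := K.toSubring.comap PowerSeries.constantCoeff
  have hR : ∀ f : PowerSeries (GaloisField p 2), f ∈ R ↔ PowerSeries.constantCoeff f ∈ K :=
    fun f => Subring.mem_comap
  haveI : Module.Finite K (GaloisField p 2) := Module.Finite.of_finite
  have hK : ∀ x : GaloisField p 2, x ^ p ∈ K → x ∈ K := fun x hx =>
    mem_fieldRange_of_pow_mem p (GaloisField p 2) 1 (by rwa [pow_one])
  exact ⟨R, inferInstance, isNoetherianRing_of_mem_iff K R hR, isLocalRing_of_mem_iff K R hR,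
    charP_of_mem_iff R p, rungTwo_of_mem_iff K R hR hK,
    not_rungThree_of_mem_iff K R hR (exists_not_mem_fieldRange p)⟩

/-- **`LocalRungClimb` is false at every prime**: it is NOT the case that every rung-2 Noetherian local
ring of characteristic `p` (domain; every s.o.p. a weakly regular sequence generating a
Frobenius-closed ideal) is rung-3 (every s.o.p. ideal tightly closed). [folklore] -/
theorem localRungClimb_false_at (p : ℕ) (hp : p.Prime) :
    ¬ (∀ (R : Type) [CommRing R] [IsNoetherianRing R] [IsLocalRing R] [CharP R p],
      (IsDomain R ∧ ∀ d : ℕ, ringKrullDim R = d → ∀ s : Fin d → R,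
        (Ideal.span (Set.range s)).radical.IsMaximal →
          RingTheory.Sequence.IsWeaklyRegular R (List.ofFn s) ∧
            ∀ y : R, (∃ e : ℕ, y ^ p ^ e ∈ Ideal.span ((fun z : R => z ^ p ^ e) ''
              (Ideal.span (Set.range s) : Set R))) → y ∈ Ideal.span (Set.range s)) →
      (IsDomain R ∧ ∀ d : ℕ, ringKrullDim R = d → ∀ s : Fin d → R,
        (Ideal.span (Set.range s)).radical.IsMaximal → ∀ y c : R, c ≠ 0 →
          (∀ e : ℕ, c * y ^ p ^ e ∈ Ideal.span ((fun z : R => z ^ p ^ e) ''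
            (Ideal.span (Set.range s) : Set R))) → y ∈ Ideal.span (Set.range s))) := by
  intro h
  obtain ⟨R, _, _, _, _, h2, h3⟩ := exists_rungTwo_not_rungThree p hp
  exact h3 (h R h2)

/-- **`LocalRungClimb` is false** ("the rung-2 model is already rung-3" fails; specialised at `p = 2`).
[folklore] -/
theorem localRungClimb_false :
    ¬ (∀ p : ℕ, p.Prime → ∀ (R : Type) [CommRing R] [IsNoetherianRing R] [IsLocalRing R] [CharP R p],
      (IsDomain R ∧ ∀ d : ℕ, ringKrullDim R = d → ∀ s : Fin d → R,
        (Ideal.span (Set.range s)).radical.IsMaximal →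
          RingTheory.Sequence.IsWeaklyRegular R (List.ofFn s) ∧
            ∀ y : R, (∃ e : ℕ, y ^ p ^ e ∈ Ideal.span ((fun z : R => z ^ p ^ e) ''
              (Ideal.span (Set.range s) : Set R))) → y ∈ Ideal.span (Set.range s)) →
      (IsDomain R ∧ ∀ d : ℕ, ringKrullDim R = d → ∀ s : Fin d → R,
        (Ideal.span (Set.range s)).radical.IsMaximal → ∀ y c : R, c ≠ 0 →
          (∀ e : ℕ, c * y ^ p ^ e ∈ Ideal.span ((fun z : R => z ^ p ^ e) ''
            (Ideal.span (Set.range s) : Set R))) → y ∈ Ideal.span (Set.range s))) := fun h =>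
  localRungClimb_false_at 2 Nat.prime_two (h 2 Nat.prime_two)

end Summit.ResolutionOfSingularities.ResolutionOfSingularities.Theorems.FRationalModification.Negative
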